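import Summits.HodgeConjecture.FermatCycles.ConditionQFourfoldSearch
import Summits.HodgeConjecture.FermatCycles.ConditionQFourfoldSeventyTwoTable
import Summits.HodgeConjecture.FermatCycles.ConditionQFourfoldSeventyTwoA
import Summits.HodgeConjecture.FermatCycles.ConditionQFourfoldSeventyTwoB
import Summits.HodgeConjecture.FermatCycles.ConditionQFourfoldSeventyTwoC
import HarnessLib

/-!
# Shioda's stable-generation condition `(Q⁴ₘ)` at `m = 72` and the failure of `(P⁴ₘ)` — kernel certificate (part D of 4)

HONEST FRAMING: explicit algebraic cycles for specific Hodge classes on Fermat/Delsarte varieties;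
residual open instances listed; no claim on general Hodge.

Topic path `Summits/HodgeConjecture/FermatCycles/` of cell `pub-hfermat` (new work, not literature: a computer determination of the cell —
`pub-hfermat-enum/P4-TABLE.md` §(Q⁴ₘ), two implementations — certified by the Lean kernel). Framework: `ConditionQFourfold.lean`
(certificate Booleans, searches `checkQU`/`checkQN`) and `ConditionQFourfoldSearch.lean` (`conditionQ_four_of_normalized`).

THE STATEMENT. Shioda, Math. Ann. 245 (1979) §4 p. 183: `(Qⁿₘ)` — every element of `Mₘ(y)`, `3 ≤ y ≤ n/2 + 1`, is `ξ₁ − ξ₂` with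
`ξ₁, ξ₂ ∈ M'ₘ = ⟨Mₘ(1), Mₘ(2), Mₘ(3)^sd⟩` (pairs, Hodge classes of the Fermat surface, semi-decomposable sextuples); by his Claim
(p. 183, Lemmas 2–3) `(Qⁿₘ)` may replace `(Pⁿₘ)` in Theorem III (`⇒` the Hodge conjecture for `Xⁿₘ`); p. 184: "we do not know any
value of `m` which satisfies `(Qₘ)` but not `(Pₘ)`". Tree: `Literature.AlgebraicGeometry.Shioda1979.ConditionQ m n`, `MPrime`,
`forall_of_conditionQ` (the Claim's arithmetic spine), `ConditionP` (Math. Ann. form of `(P)`), `FermatCharacter.ShiodaConditionUpTo`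
(Proc. Japan Acad. form, with the semi-decomposable alternative).

WHAT IS PROVED HERE (level `m = 72`, part D).
* part D of 4: the kernel searches `checkQN 72 T 15 7`, `checkQN 72 T 22 50` (81061 tuples);
* **`conditionQ_seventyTwo_four : Shioda1979.ConditionQ 72 4`** — `(Q⁴ₘ)` holds at `m = 72`: every Hodge sextuple over `ℤ/72` (every Hodge character of the
  Fermat fourfold `X⁴ₘ`, `m = 72`, up to permutation) is `ξ₁ − ξ₂`, `ξᵢ ∈ M'ₘ`;
* `forall_of_closed_cancellative_seventyTwo`: by Shioda's Claim (`forall_of_conditionQ`), every Shioda-closed, Lemma-3-cancellative family of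
  multisets over `ℤ/72` contains every non-empty Hodge multiset of cardinality `≤ 6`;
* the NEGATIVE side on the sextuple `s = (1, 6, 11, 59, 69, 70)`: Hodge (`isHodgeMultiset_fail_seventyTwo`), no proper non-empty sub-multiset with
  zero sum (`sum_ne_zero_of_mem_powerset_fail_seventyTwo`: hence not decomposable, not semi-decomposable), not quasi-decomposable (`fail_seventyTwo_key`,
  `72 · 2⁸` kernel cases) ⇒ **`not_shiodaConditionUpTo_seventyTwo_four : ¬ ShiodaConditionUpTo 72 4`** (the Proc. Japan Acad. form of `(P⁴ₘ)`
  fails), `not_conditionP_seventyTwo_four : ¬ Shioda1979.ConditionP 72 4` (the Math. Ann. form fails), and the conjunction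
  `conditionQ_not_conditionP_seventyTwo : ConditionQ 72 4 ∧ ¬ ConditionP 72 4` — at `m = 72`, for fourfolds, Shioda's weakening `(Q)` of `(P)` is
  NECESSARY as well as sufficient.

NUMBERS (this seat's search `code/lit/q4/q4norm.py` = implementation 2; implementation 1 = ENUM `code/enum/q4table.py`,
`data/shioda_Q4_m3-100.json`): case U visits 110816 sorted tuples and case N 227250; 8862 of them are Hodge sextuples; all but 159 carry a
`(P)`-witness (case N pair 6152, case N quasi 1282, case N semi 232, case U pair 951, case U quasi 81, case U semi 5); the other 159 — `(1, 6, 11, 59, 69, 70)` (case U); `(1, 10, 25, 57, 59, 64)` (case U); `(1, 10, 37, 50, 52, 66)` (case U); `(1, 10, 37, 50, 54, 64)` (case U); `(1, 10, 37, 54, 56, 58)` (case U); `(1, 11, 18, 57, 59, 70)` (case U); `(1, 11, 24, 51, 59, 70)` (case U); `(1, 11, 26, 50, 59, 69)` (case U); `(1, 11, 38, 51, 56, 59)` (case U); `(1, 11, 39, 46, 49, 70)` (case U); `(1, 11, 39, 49, 50, 66)` (case U); `(1, 11, 40, 49, 57, 58)` (case U); `(1, 11, 48, 49, 50, 57)`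 (case U); `(1, 11, 49, 50, 51, 54)` (case U); `(1, 13, 37, 49, 50, 66)` (case U); `(1, 19, 37, 40, 55, 64)` (case U); `(1, 19, 37, 48, 55, 56)` (case U); `(1, 22, 25, 39, 59, 70)` (case U); `(1, 25, 26, 37, 61, 66)` (case U); `(1, 25, 26, 39, 59, 66)` (case U); `(1, 25, 26, 48, 57, 59)` (case U); `(1, 25, 26, 51, 54, 59)` (case U); `(1, 26, 28, 37, 58, 66)` (case U); `(1, 26, 33, 37, 50, 69)` (case U); `(1, 26, 37, 40, 54, 58)` (case U); `(1, 26, 37, 42, 50, 60)` (case U); `(1, 26, 37, 48, 50, 54)` (case U); `(2, 8, 26, 54, 58, 68)` (case N); `(2, 10, 21, 50, 64, 69)` (case N); `(2, 10, 21, 56, 58, 69)` (case N); `(2, 10, 21, 57, 58, 68)` (case N); `(2, 10, 24, 54, 58, 68)` (case N); `(2, 10, 24, 56, 58, 66)` (case N); `(2, 10, 27, 50, 63, 64)` (case N); `(2, 10, 27, 56, 58, 63)` (case N); `(2, 10, 28, 52, 58, 66)` (case N); `(2, 10, 28, 54, 58, 64)` (case N); `(2, 10, 32, 50, 54, 68)`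 (case N); `(2, 10, 33, 50, 52, 69)` (case N); `(2, 10, 33, 50, 57, 64)` (case N); `(2, 10, 33, 56, 57, 58)` (case N); `(2, 10, 36, 50, 54, 64)` (case N); `(2, 10, 36, 54, 56, 58)` (case N); `(2, 10, 40, 52, 54, 58)` (case N); `(2, 10, 42, 44, 50, 68)` (case N); `(2, 10, 42, 48, 50, 64)` (case N); `(2, 10, 44, 50, 54, 56)` (case N); `(2, 10, 48, 50, 52, 54)` (case N); `(2, 14, 38, 50, 52, 60)` (case N); `(2, 20, 26, 42, 58, 68)` (case N); `(2, 20, 26, 54, 56, 58)` (case N); `(2, 21, 26, 40, 58, 69)` (case N); `(2, 26, 27, 40, 58, 63)` (case N); `(2, 26, 28, 33, 58, 69)` (case N); `(2, 26, 28, 38, 60, 62)` (case N); `(2, 26, 28, 48, 54, 58)` (case N); `(2, 26, 33, 40, 57, 58)` (case N); `(2, 26, 36, 40, 54, 58)` (case N); `(2, 26, 40, 42, 48, 58)` (case N); `(2, 28, 30, 38, 52, 66)` (case N); `(3, 8, 22, 51, 62, 70)` (case N); `(3, 14, 16, 51, 62, 70)` (case N); `(3, 14, 32, 46, 51, 70)`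 (case N); `(3, 14, 38, 46, 51, 64)` (case N); `(3, 14, 39, 44, 46, 70)` (case N); `(3, 20, 22, 39, 62, 70)` (case N); `(3, 22, 38, 39, 46, 68)` (case N); `(3, 22, 38, 40, 51, 62)` (case N); `(3, 22, 38, 46, 51, 56)` (case N); `(4, 10, 34, 50, 52, 66)` (case N); `(4, 10, 34, 50, 54, 64)` (case N); `(4, 14, 15, 51, 62, 70)` (case N); `(4, 14, 18, 46, 64, 70)` (case N); `(4, 14, 18, 48, 62, 70)` (case N); `(4, 14, 26, 50, 60, 62)` (case N); `(4, 14, 30, 46, 52, 70)` (case N); `(4, 14, 30, 50, 52, 66)` (case N); `(4, 18, 22, 40, 62, 70)` (case N); `(4, 22, 28, 30, 62, 70)` (case N); `(4, 26, 28, 30, 62, 66)` (case N); `(4, 26, 28, 34, 58, 66)` (case N); `(4, 26, 33, 34, 50, 69)` (case N); `(4, 26, 34, 40, 54, 58)` (case N); `(4, 26, 34, 48, 50, 54)` (case N); `(6, 10, 42, 44, 46, 68)` (case N); `(6, 14, 16, 48, 62, 70)` (case N); `(6, 14, 20, 44, 62, 70)` (case N); `(6, 14, 38, 44, 46, 68)`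 (case N); `(6, 14, 38, 46, 48, 64)` (case N); `(6, 20, 22, 38, 62, 68)` (case N); `(6, 20, 22, 42, 58, 68)` (case N); `(6, 20, 34, 42, 44, 70)` (case N); `(6, 22, 38, 40, 48, 62)` (case N); `(8, 9, 22, 45, 62, 70)` (case N); `(8, 14, 18, 44, 62, 70)` (case N); `(8, 15, 22, 39, 62, 70)` (case N); `(8, 18, 22, 36, 62, 70)` (case N); `(8, 18, 22, 38, 62, 68)` (case N); `(8, 21, 26, 34, 58, 69)` (case N); `(8, 22, 24, 30, 62, 70)` (case N); `(8, 24, 26, 34, 58, 66)` (case N); `(8, 26, 27, 34, 58, 63)` (case N); `(8, 26, 33, 34, 57, 58)` (case N); `(8, 26, 34, 36, 54, 58)` (case N); `(8, 26, 34, 44, 50, 54)` (case N); `(9, 14, 16, 45, 62, 70)` (case N); `(9, 14, 32, 45, 46, 70)` (case N); `(9, 14, 38, 45, 46, 64)` (case N); `(9, 22, 38, 40, 45, 62)` (case N); `(9, 22, 38, 45, 46, 56)` (case N); `(10, 12, 22, 46, 58, 68)` (case N); `(10, 12, 34, 44, 46, 70)` (case N); `(10, 16, 34, 50, 52, 54)`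 (case N); `(10, 21, 32, 34, 50, 69)` (case N); `(10, 21, 34, 44, 50, 57)` (case N); `(10, 24, 32, 34, 50, 66)` (case N); `(10, 24, 34, 44, 50, 54)` (case N); `(10, 27, 32, 34, 50, 63)` (case N); `(10, 32, 33, 34, 50, 57)` (case N); `(10, 32, 34, 36, 50, 54)` (case N); `(12, 20, 22, 34, 58, 70)` (case N); `(14, 15, 16, 39, 62, 70)` (case N); `(14, 15, 32, 39, 46, 70)` (case N); `(14, 15, 38, 39, 46, 64)` (case N); `(14, 15, 38, 46, 51, 52)` (case N); `(14, 16, 18, 36, 62, 70)` (case N); `(14, 16, 18, 46, 52, 70)` (case N); `(14, 18, 20, 32, 62, 70)` (case N); `(14, 18, 24, 44, 46, 70)` (case N); `(14, 18, 32, 36, 46, 70)` (case N); `(14, 18, 32, 38, 46, 68)` (case N); `(14, 18, 36, 38, 46, 64)` (case N); `(14, 18, 38, 44, 46, 56)` (case N); `(14, 18, 38, 46, 48, 52)` (case N); `(14, 24, 30, 32, 46, 70)` (case N); `(15, 22, 28, 38, 51, 62)` (case N); `(15, 22, 38, 39, 40, 62)` (case N); `(15, 22, 38, 39, 46, 56)`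 (case N); `(16, 18, 22, 28, 62, 70)` (case N); `(16, 21, 26, 34, 50, 69)` (case N); `(16, 26, 27, 34, 50, 63)` (case N); `(16, 26, 28, 34, 54, 58)` (case N); `(16, 26, 33, 34, 50, 57)` (case N); `(16, 26, 34, 36, 50, 54)` (case N); `(16, 26, 34, 42, 48, 50)` (case N); `(18, 20, 22, 24, 62, 70)` (case N); `(18, 20, 22, 38, 56, 62)` (case N); `(18, 22, 24, 38, 46, 68)` (case N); `(18, 22, 28, 38, 46, 64)` (case N); `(18, 22, 28, 38, 48, 62)` (case N); `(18, 22, 36, 38, 40, 62)` (case N); `(18, 22, 36, 38, 46, 56)` (case N); `(18, 22, 38, 40, 46, 52)` (case N); `(20, 21, 26, 34, 57, 58)` (case N); `(20, 24, 26, 34, 54, 58)` (case N); `(20, 26, 32, 34, 50, 54)` (case N); `(20, 26, 34, 42, 44, 50)` (case N); `(22, 24, 30, 38, 46, 56)` (case N); `(22, 28, 30, 38, 46, 52)` (case N) — carry the table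
certificate(s) written out in the statements below (generators checked by `genB`, the identity `s + ΣX = ΣY` by `decide`, all inside the kernel search).

PRINT STATUS (lit seat, 2026-08-20). `72 = 2³·3²`: HC for every `Xⁿ₇₂` IS in print (Aoki 2000 Thm 0.1 (i), p. 185). The point of this level is Shioda's QUESTION (p. 184): `(Q⁴₇₂)` holds while `(P⁴₇₂)` fails; `72` has the second-largest certificate table of the twenty levels (159 sextuples without a `(P)`-witness; cell table, two implementations; kernel here).

References: [Shioda1979HodgeFermat] T. Shioda, Math. Ann. 245 (1979) 175–184, §3 p. 180 (`(Pⁿₘ)`), §4 pp. 183–184 (`M'ₘ`, `(Qⁿₘ)`, Claim,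
the question); [Shioda1979PJA] T. Shioda, Proc. Japan Acad. 55A (1979) §1 (Definition (i)–(iii), `(Pⁿₘ)'`); [daSilva2021HodgeFermat]
G. da Silva Jr., Experimental Results 2 (2021) e22, Def. 2.4, Question 1; [Aoki2000FermatTypeRemarks] N. Aoki, Comment. Math. Univ.
St. Pauli 49 (2000), Thm 0.1. Cell: `pub-hfermat-enum/P4-TABLE.md`, `data/shioda_Q4_m3-100.json`, `code/lit/q4/` (this seat).
-/

namespace Summit.HodgeConjecture.FermatCycles.ConditionQFourfold

open Multiset
open Literature.AlgebraicGeometry.HodgeTheory Literature.AlgebraicGeometry.HodgeTheory.FermatCharacter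
open Literature.AlgebraicGeometry.Shioda1982 Literature.AlgebraicGeometry.Shioda1979
open Summit.HodgeConjecture.FermatCycles.ShiodaConditionFourfold

/-! ### Level `72` — part D -/

/-! The certificate table at level `72` is the definition `table72` of `ConditionQFourfoldSeventyTwoTable.lean` (159 entries `(key, X, Y)`,
`s + ΣX = ΣY`; found by `code/lit/q4/q4norm.py`, every entry checked by the kernel inside the searches). -/

set_option maxHeartbeats 0 in
/-- The `(Q)`-search at level `72`, case N, first free representative in `[15, 22)` (64495 tuples). Kernel.
[cite: Shioda1979HodgeFermat, §4 condition (Qⁿₘ), p. 183] -/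
theorem checkQN_72_15 :
    checkQN 72
      table72
      15 7 = true := by
  decide +kernel

set_option maxHeartbeats 0 in
/-- The `(Q)`-search at level `72`, case N, first free representative in `[22, 72)` (16566 tuples). Kernel.
[cite: Shioda1979HodgeFermat, §4 condition (Qⁿₘ), p. 183] -/
theorem checkQN_72_22 :
    checkQN 72
      table72
      22 50 = true := by
  decide +kernel

/-- **`(Q⁴ₘ)` holds at `m = 72`**: every Hodge sextuple over `ℤ/72` is `ξ₁ − ξ₂` with `ξ₁, ξ₂ ∈ M'ₘ` (stably generated by pairs, Hodge
`4`-sets and semi-decomposable sextuples). Kernel certificate of the cell's entry `72 ∈ Q4_true_P4_false` (P4-TABLE §(Q⁴ₘ)).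
[cite: Shioda1979HodgeFermat, §4 condition (Qⁿₘ), p. 183] -/
theorem conditionQ_seventyTwo_four : ConditionQ 72 4 :=
  haveI : Fact (1 < 72) := ⟨by norm_num⟩
  conditionQ_four_of_normalized 72
    table72
    [(1, 18), (19, 53)]
    (by
      intro b h0 hN
      rcases Nat.lt_or_ge b 19 with h0 | h0
      · exact ⟨(1, 18), by simp, by omega, by omega⟩
      exact ⟨(19, 53), by simp, by omega, by omega⟩)
    (by
      intro p hp
      simp only [List.mem_cons, List.not_mem_nil, or_false] at hp
      rcases hp with rfl | rfl
      · exact checkQU_72_1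
      · exact checkQU_72_19)
    [(1, 3), (4, 4), (8, 2), (10, 5), (15, 7), (22, 50)]
    (by
      intro a h0 hN
      rcases Nat.lt_or_ge a 4 with h0 | h0
      · exact ⟨(1, 3), by simp, by omega, by omega⟩
      rcases Nat.lt_or_ge a 8 with h1 | h1
      · exact ⟨(4, 4), by simp, by omega, by omega⟩
      rcases Nat.lt_or_ge a 10 with h2 | h2
      · exact ⟨(8, 2), by simp, by omega, by omega⟩
      rcases Nat.lt_or_ge a 15 with h3 | h3
      · exact ⟨(10, 5), by simp, by omega, by omega⟩
      rcases Nat.lt_or_ge a 22 with h4 | h4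
      · exact ⟨(15, 7), by simp, by omega, by omega⟩
      exact ⟨(22, 50), by simp, by omega, by omega⟩)
    (by
      intro p hp
      simp only [List.mem_cons, List.not_mem_nil, or_false] at hp
      rcases hp with rfl | rfl | rfl | rfl | rfl | rfl
      · exact checkQN_72_1
      · exact checkQN_72_4
      · exact checkQN_72_8
      · exact checkQN_72_10
      · exact checkQN_72_15
      · exact checkQN_72_22)

/-- **Shioda's Claim at `m = 72`**: every family of multisets over `ℤ/72` closed under the inductive structure of Fermat varieties
(pairs, surface classes, semi / star / hash) and under Lemma 3's cancellation contains every non-empty Hodge multiset with at most `6`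
elements — the arithmetic form of "`(Q⁴ₘ)` ⇒ the Hodge conjecture for `X⁴ₘ`" at `m = 72` (geometric inputs = the hypotheses, as printed).
[cite: Shioda1979HodgeFermat, §4 Claim, Lemmas 2–3, p. 183] -/
theorem forall_of_closed_cancellative_seventyTwo {C : Multiset (ZMod 72) → Prop} (hC : IsShiodaClosed C) (hL : IsCancellative C) :
    ∀ s : Multiset (ZMod 72), s ≠ 0 → IsHodgeMultiset s → card s ≤ 6 → C s :=
  forall_of_conditionQ hC hL conditionQ_seventyTwo_four

/-! ### The negative side at `m = 72`: `(P⁴ₘ)` fails on `s = (1, 6, 11, 59, 69, 70)` -/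

/-- `s` is a Hodge sextuple over `ℤ/72` (a Hodge character of the Fermat fourfold of degree `72`). [cite: Shioda1979PJA, §1 eqs. (2)–(3)] -/
theorem isHodgeMultiset_fail_seventyTwo : IsHodgeMultiset ({1, 6, 11, 59, 69, 70} : Multiset (ZMod 72)) :=
  isHodgeMultiset_of_hodgeUB (N := 72) (by decide +kernel)

/-- Every proper non-empty sub-multiset of `s` has non-zero sum: `s` contains no pair `{a, −a}`, no Hodge sub-multiset, no zero-sum
triple. [cite: Shioda1979PJA, §1 Definition (i), (iii)] -/
theorem sum_ne_zero_of_mem_powerset_fail_seventyTwo :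
    ∀ t ∈ Multiset.powerset ({1, 6, 11, 59, 69, 70} : Multiset (ZMod 72)), t ≠ 0 → ({1, 6, 11, 59, 69, 70} : Multiset (ZMod 72)) - t ≠ 0 → t.sum ≠ 0 := by
  decide +kernel

/-- `s` is **not decomposable** (a summand would be a proper non-empty zero-sum sub-multiset). [cite: Shioda1979PJA, §1 Definition (i)] -/
theorem not_isDecomposable_fail_seventyTwo : ¬ IsDecomposable ({1, 6, 11, 59, 69, 70} : Multiset (ZMod 72)) := by
  rintro ⟨t, u, ht0, hu0, ht, -, heq⟩
  have htle : t ≤ ({1, 6, 11, 59, 69, 70} : Multiset (ZMod 72)) := heq ▸ Multiset.le_add_right t u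
  have hu : ({1, 6, 11, 59, 69, 70} : Multiset (ZMod 72)) - t = u := by rw [heq, add_tsub_cancel_left]
  exact sum_ne_zero_of_mem_powerset_fail_seventyTwo t (Multiset.mem_powerset.2 htle) ht0 (hu ▸ hu0) ht.1.2

/-- `s` is **not semi-decomposable** (no zero-sum triple). [cite: Shioda1979PJA, §1 Definition (iii)] -/
theorem not_isSemiDecomposable_fail_seventyTwo : ¬ IsSemiDecomposable ({1, 6, 11, 59, 69, 70} : Multiset (ZMod 72)) := by
  rintro ⟨t, u, ht3, hu3, hts, -, heq⟩
  have htle : t ≤ ({1, 6, 11, 59, 69, 70} : Multiset (ZMod 72)) := heq ▸ Multiset.le_add_right t u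
  have hu : ({1, 6, 11, 59, 69, 70} : Multiset (ZMod 72)) - t = u := by rw [heq, add_tsub_cancel_left]
  have ht0 : t ≠ 0 := by rintro rfl; simp at ht3
  have hu0 : u ≠ 0 := by rintro rfl; simp at hu3
  exact sum_ne_zero_of_mem_powerset_fail_seventyTwo t (Multiset.mem_powerset.2 htle) ht0 (hu ▸ hu0) hts

/-- A Hodge multiset over `ℤ/72` satisfies the finitely many conditions used by the kernel refutation below (entries non-zero, sum
zero, Shioda's norm equation at the units `1, 7, 11, 13, 19` — a sub-family of Shioda's equations (2) that already admits no splitting, chosen by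
`code/lit/q4/minunits.py`). [cite: Shioda1979PJA, §1 eq. (2)] -/
theorem hodgeConditions_seventyTwo {v : Multiset (ZMod 72)} (hv : IsHodgeMultiset v) :
    ((v).sum = 0 ∧ (∀ a ∈ v, a ≠ 0) ∧
            2 * mNormSum ((v).map fun a ↦ (1 : ZMod 72) * a) = 72 * Multiset.card (v) ∧
            2 * mNormSum ((v).map fun a ↦ (7 : ZMod 72) * a) = 72 * Multiset.card (v) ∧
            2 * mNormSum ((v).map fun a ↦ (11 : ZMod 72) * a) = 72 * Multiset.card (v) ∧
            2 * mNormSum ((v).map fun a ↦ (13 : ZMod 72) * a) = 72 * Multiset.card (v) ∧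
            2 * mNormSum ((v).map fun a ↦ (19 : ZMod 72) * a) = 72 * Multiset.card (v)) := by
  have h1 := hv.2 (Units.mkOfMulEqOne 1 1 (by decide))
  have h7 := hv.2 (Units.mkOfMulEqOne 7 31 (by decide))
  have h11 := hv.2 (Units.mkOfMulEqOne 11 59 (by decide))
  have h13 := hv.2 (Units.mkOfMulEqOne 13 61 (by decide))
  have h19 := hv.2 (Units.mkOfMulEqOne 19 19 (by decide))
  simp only [Units.val_mkOfMulEqOne] at h1 h7 h11 h13 h19
  exact ⟨hv.1.2, hv.1.1, h1, h7, h11, h13, h19⟩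

set_option maxHeartbeats 0 in
/-- The arithmetic heart of "`s` is **not quasi-decomposable**": for every `e ∈ ℤ/72` and every splitting `s + {e, −e} = t + u` into
non-empty parts different from `s`, one of `t`, `u` violates a condition of `hodgeConditions_seventyTwo` (the zero-sum test comes first, so
the kernel discards almost every splitting on one addition). Kernel, one residue `e` at a time (`72 · 2⁸` cases). [cite: daSilva2021HodgeFermat, Def. 2.4] [cite: Shioda1979PJA, §1 Definition (ii)] -/
theorem fail_seventyTwo_key :
    ∀ e : ZMod 72, ∀ t ∈ Multiset.powerset (({1, 6, 11, 59, 69, 70} : Multiset (ZMod 72)) + {e, -e}),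
      ¬ (((t).sum = 0 ∧ (∀ a ∈ t, a ≠ 0) ∧
            2 * mNormSum ((t).map fun a ↦ (1 : ZMod 72) * a) = 72 * Multiset.card (t) ∧
            2 * mNormSum ((t).map fun a ↦ (7 : ZMod 72) * a) = 72 * Multiset.card (t) ∧
            2 * mNormSum ((t).map fun a ↦ (11 : ZMod 72) * a) = 72 * Multiset.card (t) ∧
            2 * mNormSum ((t).map fun a ↦ (13 : ZMod 72) * a) = 72 * Multiset.card (t) ∧
            2 * mNormSum ((t).map fun a ↦ (19 : ZMod 72) * a) = 72 * Multiset.card (t)) ∧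
          (((({1, 6, 11, 59, 69, 70} : Multiset (ZMod 72)) + {e, -e}) - t).sum = 0 ∧ (∀ a ∈ (({1, 6, 11, 59, 69, 70} : Multiset (ZMod 72)) + {e, -e}) - t, a ≠ 0) ∧
            2 * mNormSum (((({1, 6, 11, 59, 69, 70} : Multiset (ZMod 72)) + {e, -e}) - t).map fun a ↦ (1 : ZMod 72) * a) = 72 * Multiset.card ((({1, 6, 11, 59, 69, 70} : Multiset (ZMod 72)) + {e, -e}) - t) ∧
            2 * mNormSum (((({1, 6, 11, 59, 69, 70} : Multiset (ZMod 72)) + {e, -e}) - t).map fun a ↦ (7 : ZMod 72) * a) = 72 * Multiset.card ((({1, 6, 11, 59, 69, 70} : Multiset (ZMod 72)) + {e, -e}) - t) ∧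
            2 * mNormSum (((({1, 6, 11, 59, 69, 70} : Multiset (ZMod 72)) + {e, -e}) - t).map fun a ↦ (11 : ZMod 72) * a) = 72 * Multiset.card ((({1, 6, 11, 59, 69, 70} : Multiset (ZMod 72)) + {e, -e}) - t) ∧
            2 * mNormSum (((({1, 6, 11, 59, 69, 70} : Multiset (ZMod 72)) + {e, -e}) - t).map fun a ↦ (13 : ZMod 72) * a) = 72 * Multiset.card ((({1, 6, 11, 59, 69, 70} : Multiset (ZMod 72)) + {e, -e}) - t) ∧
            2 * mNormSum (((({1, 6, 11, 59, 69, 70} : Multiset (ZMod 72)) + {e, -e}) - t).map fun a ↦ (19 : ZMod 72) * a) = 72 * Multiset.card ((({1, 6, 11, 59, 69, 70} : Multiset (ZMod 72)) + {e, -e}) - t)) ∧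
          t ≠ 0 ∧ (({1, 6, 11, 59, 69, 70} : Multiset (ZMod 72)) + {e, -e}) - t ≠ 0 ∧ t ≠ ({1, 6, 11, 59, 69, 70} : Multiset (ZMod 72)) ∧ (({1, 6, 11, 59, 69, 70} : Multiset (ZMod 72)) + {e, -e}) - t ≠ ({1, 6, 11, 59, 69, 70} : Multiset (ZMod 72))) := by
  intro e
  obtain ⟨k, hk, rfl⟩ : ∃ k < 72, ((k : ℕ) : ZMod 72) = e :=
    ⟨e.val, e.val_lt, ZMod.natCast_zmod_val e⟩
  interval_cases k <;> decide +kernel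

/-- `s` is **not quasi-decomposable** (no `e ≠ 0` with `s + {e, −e} = ξ' + ξ''`, `ξ', ξ''` Hodge, both different from `s`).
[cite: daSilva2021HodgeFermat, Def. 2.4] [cite: Shioda1979PJA, §1 Definition (ii)] -/
theorem not_isQuasiDecomposable_fail_seventyTwo : ¬ IsQuasiDecomposable ({1, 6, 11, 59, 69, 70} : Multiset (ZMod 72)) := by
  rintro ⟨e, -, t, u, ht0, hu0, ht, hu, hts, hus, heq⟩
  have htle : t ≤ ({1, 6, 11, 59, 69, 70} : Multiset (ZMod 72)) + {e, -e} := heq ▸ Multiset.le_add_right t u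
  have hu' : ({1, 6, 11, 59, 69, 70} : Multiset (ZMod 72)) + {e, -e} - t = u := by rw [heq, add_tsub_cancel_left]
  subst hu'
  exact fail_seventyTwo_key e t (Multiset.mem_powerset.2 htle)
    ⟨hodgeConditions_seventyTwo ht, hodgeConditions_seventyTwo hu, ht0, hu0, hts, hus⟩

/-- **`(P⁴ₘ)` fails at `m = 72`** (Proc. Japan Acad. form, tree `ShiodaConditionUpTo 72 4`): the Hodge sextuple `s` is neither decomposable,
nor quasi-decomposable, nor semi-decomposable. Kernel certificate of the cell's P4-TABLE entry (two implementations + referee).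
[cite: Shioda1979PJA, §1 condition (Pⁿₘ)] -/
theorem not_shiodaConditionUpTo_seventyTwo_four : ¬ ShiodaConditionUpTo 72 4 := fun h ↦ by
  rcases h _ isHodgeMultiset_fail_seventyTwo (by decide) (by decide) with hd | hq | hs
  · exact not_isDecomposable_fail_seventyTwo hd
  · exact not_isQuasiDecomposable_fail_seventyTwo hq
  · exact not_isSemiDecomposable_fail_seventyTwo hs

/-- Hence `(Pₘ)` (Proc. Japan Acad. form, all lengths) fails at `m = 72`. [cite: Shioda1979PJA, §1 conditions (Pⁿₘ), (Pₘ)] -/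
theorem not_shiodaCondition_seventyTwo : ¬ ShiodaCondition 72 := fun h ↦
  not_shiodaConditionUpTo_seventyTwo_four (shiodaCondition_iff_forall_upTo.1 h 4)

/-- **The Math. Ann. form of `(P⁴ₘ)` fails at `m = 72`** too: `s` is indecomposable and not quasi-decomposable.
[cite: Shioda1979HodgeFermat, §3 condition (Pⁿₘ), p. 180] -/
theorem not_conditionP_seventyTwo_four : ¬ ConditionP 72 4 := fun h ↦
  not_isQuasiDecomposable_fail_seventyTwo
    (h _ isHodgeMultiset_fail_seventyTwo (by decide) (by decide) not_isDecomposable_fail_seventyTwo)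

/-- Hence the Math. Ann. condition `(Pₘ)` fails at `m = 72`. [cite: Shioda1979HodgeFermat, §3 condition (Pₘ), p. 180] -/
theorem not_conditionPAll_seventyTwo : ¬ ConditionPAll 72 := fun h ↦
  not_conditionP_seventyTwo_four (conditionPAll_iff_forall.1 h 4)

/-- **Shioda's question (Math. Ann. 245, p. 184), the fourfold instance at `m = 72`**: "we do not know any value of `m` which satisfies
`(Qₘ)` but not `(Pₘ)`" — at `m = 72` the length-`3` condition `(Q⁴ₘ)` HOLDS while `(P⁴ₘ)` FAILS (in both printed forms). Whether `(Qₘ)` holds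
at ALL lengths for `m = 72` is not decided here. Computer-assisted (cell `pub-hfermat`, two implementations), certified by the kernel.
[cite: Shioda1979HodgeFermat, §4, p. 184 (the question)] -/
theorem conditionQ_not_conditionP_seventyTwo : ConditionQ 72 4 ∧ ¬ ConditionP 72 4 :=
  ⟨conditionQ_seventyTwo_four, not_conditionP_seventyTwo_four⟩

end Summit.HodgeConjecture.FermatCycles.ConditionQFourfold
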